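import Literature.NumberTheory.NumberFields.EquivariantIwasawaLemmaCompositum
import Literature.NumberTheory.NumberFields.ArtinMapDecompositionInertia
import Literature.NumberTheory.EllipticCurves.ZpExtensionUnramifiedProofs
import Literature.NumberTheory.EllipticCurves.ZpExtensionLayerCharacter
import Literature.NumberTheory.EllipticCurves.GreenbergSelmer
import Literature.NumberTheory.GaloisRepresentations.DecompositionGroupOfCompletion
import HarnessLib

/-!
# The equivariant Iwasawa lemma, VI: the ramification inputs for `L₀ K_n`, `K_n` the layers of a
# `ℤ_p`-extension — ramified primes lie over `p`, and (c3*) from the decomposition groups `D_v`, `v ∣ p`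

Topic `NumberTheory/NumberFields` (namespace = path, grouping sub-namespace `EquivariantIwasawaLemma`).
THEOREM-ONLY file (no definition, no named fact, no `sorry`), written by the literature seat
`bsd-potss-conjA-anchor` g16 (cell `bsd-potss`; serves stmt-BirchSwinnertonDyer-19386 / 19413; closes
nothing; neither Conjecture A nor BSD is proved for any curve here).  Sequel of
`EquivariantIwasawaLemmaCompositum.lean`: of the two ramification hypotheses left there to the consumer,
the first — (c3*)ₙ «no non-zero vector of `V` is fixed by the stabiliser in `Γ_k` of a prime `𝔓` of
`L₀K_{n+1}` ramified over `L₀K_n`» — is DISCHARGED here from the place-wise hypothesis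
«`V^{D_v} = 0` for every finite place `v ∣ p` of `k`» (`D_v = GreenbergSelmer.decomp v`, the
decomposition group of the tree's chosen prime above `v`), for `K_n = ZpExtension.layer κ n` the layers
of ANY `ℤ_p`-extension `κ` of `k`:

* `natCast_mem_of_mem_inertia_of_absRestrictNormalHom_layer_ne_one` — **a prime `𝔓` of a finite
  Galois `F ⊇ K_m` whose inertia group contains `σ|_F` with `σ|_{K_m} ≠ 1` contains `p`**: lift `σ|_F`
  to an element `g` of the absolute inertia group `I_𝔓̄ ≤ Γ_k` of a prime `𝔓̄` of `ℤ̄_k` above `𝔓`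
  (Serre, *Local Fields* I §7 Prop. 22 (b); tree `inertia_comap_ringOfIntegers_eq_map_absRestrictNormalHom`);
  if `p ∉ 𝔓` then `I_𝔓̄ ≤ ker κ` (`ℤ_p`-extensions are unramified outside `p`, Washington Prop. 13.2, tree
  `ZpExtension.inertia_le_kerSubgroup_holds`), so `g|_{K_m} = 1 = σ|_{K_m}`, contradiction.
* `eq_zero_of_forall_stabilizer_smul_of_decomp` — **`V^{Stab_Γ(𝔓)} ⊆ g • V^{D_v} = 0`** for a prime
  `𝔓 ∋ p` of `F` over the place `v` of `k`: `𝔓 = 𝔓̄ ∩ F` with `𝔓̄ = g • 𝔓₀`, `𝔓₀` the chosen prime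
  above `v` (transitivity, Neukirch I (9.1), tree `exists_smul_eq_of_mem_primesAbove_holds`;
  `D_v = Stab_Γ(𝔓₀)`, tree `decompositionSubgroup_adicCompletionPrime_eq_range`), and
  `Stab_Γ(𝔓̄) ≤ Stab_Γ(𝔓̄ ∩ F)`.
* **`equivariantHom_classGroup_eq_zero_layer_compositum_tower`** — door L6 of the cell's census as a
  theorem MODULO ONE INPUT per layer: `k` a number field, `p` odd, `κ` a `ℤ_p`-extension of `k` with
  layers `K_n`, `L₀/k` finite Galois with `p ∤ [L₀ : k]`, `V` a `p`-torsion `Γ_k`-module on which `Γ_{L₀}`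
  acts trivially, (c2*) `Hom_{Γ_k}(Cl(L₀), V) = 0`, (c3*) `V^{D_v} = 0` for all `v ∣ p`; INPUT (orbit)ₙ: a
  prime `𝔓̄` of `ℤ̄_k` and `σ ∈ I_𝔓̄` with `σ|_{L₀} = 1`, `σ ∈ κ⁻¹(pⁿℤ_p) ∖ κ⁻¹(pⁿ⁺¹ℤ_p)`, such that the prime
  `𝔓̄ ∩ L₀K_{n+1}` has a number of `Gal(L₀K_{n+1}/k)`-conjugates prime to `p` ⟹
  `Hom_{Γ_k}(Cl(L₀K_n), V) = 0` for every `n`.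

## References

* L. C. Washington, *Introduction to Cyclotomic Fields*, 2nd ed., GTM 83 (1997), §13.1, Prop. 13.2,
  §13.3 Lemmas 13.14–13.15, Thm. 10.4. [Washington1997]
* J.-P. Serre, *Local Fields*, GTM 67 (1979), Ch. I §7 Prop. 22. [SerreLocalFields1979]
* J. Neukirch, *Algebraic Number Theory* (1999), Ch. I §9 (9.1); Ch. II (9.6). [NeukirchANT1999]
* R. Greenberg, *Iwasawa theory for p-adic representations*, Adv. Stud. Pure Math. 17 (1989), §1 p. 98
  (the groups `D_v`). [Greenberg1989]
-/

noncomputable section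

open scoped Pointwise nonZeroDivisors
open NumberField Field IntermediateField Ideal IsDedekindDomain
open Literature.NumberTheory.GaloisRepresentations
open Literature.NumberTheory.EllipticCurves (ringOfIntegersToIntegralClosure
  coe_ringOfIntegersToIntegralClosure ringOfIntegersToIntegralClosure_comp_algebraMap
  ringOfIntegersToIntegralClosure_injective ZpExtension)

namespace Literature.NumberTheory.NumberFields

namespace EquivariantIwasawaLemma

section Ramification

variable {k : Type} [Field k]

/-! ### Helpers: primes of `ℤ̄_k` above a prime of a finite `F ⊆ k̄` -/

/-- A prime of `ℤ̄_k` above a given prime of `𝓞 F` (`F ⊆ k̄` a number field): lying over for the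
integral extension `𝓞 F → ℤ̄_k`. [folklore] -/
private theorem exists_isPrime_comap_eq (F : IntermediateField k (AlgebraicClosure k))
    (Q : Ideal (𝓞 F)) [Q.IsPrime] :
    ∃ 𝔓 : Ideal (absIntegers (𝓞 k) k), 𝔓.IsPrime ∧
      𝔓.comap (ringOfIntegersToIntegralClosure (k := k) (Ω := AlgebraicClosure k) F) = Q := by
  set φ : 𝓞 F →+* absIntegers (𝓞 k) k :=
    ringOfIntegersToIntegralClosure (k := k) (Ω := AlgebraicClosure k) F with hφ
  have hφalg : ∀ x : 𝓞 k, φ (algebraMap (𝓞 k) (𝓞 F) x) =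
      algebraMap (𝓞 k) (absIntegers (𝓞 k) k) x := fun x ↦ rfl
  letI : Algebra (𝓞 F) (absIntegers (𝓞 k) k) := φ.toAlgebra
  haveI : IsScalarTower (𝓞 k) (𝓞 F) (absIntegers (𝓞 k) k) :=
    IsScalarTower.of_algebraMap_eq fun x ↦ (hφalg x).symm
  haveI : Algebra.IsIntegral (𝓞 F) (absIntegers (𝓞 k) k) :=
    ⟨fun x ↦ (Algebra.IsIntegral.isIntegral (R := 𝓞 k) x).tower_top⟩
  obtain ⟨𝔓, -, h𝔓prime, h𝔓Q⟩ := Ideal.exists_ideal_over_prime_of_isIntegral Q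
    (⊥ : Ideal (absIntegers (𝓞 k) k))
    (fun x hx ↦ by
      rw [Ideal.mem_comap, Ideal.mem_bot] at hx
      have hx0 : x = 0 :=
        ringOfIntegersToIntegralClosure_injective F (hx.trans (map_zero _).symm)
      rw [hx0]
      exact Q.zero_mem)
  exact ⟨𝔓, h𝔓prime, h𝔓Q⟩

/-- `ℤ̄_k` is integral over `𝓞 F` along `ι_F`. [folklore] -/
private theorem isIntegral_ringOfIntegersToIntegralClosure (F : IntermediateField k (AlgebraicClosure k)) :
    (ringOfIntegersToIntegralClosure (k := k) (Ω := AlgebraicClosure k) F).IsIntegral := by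
  letI : Algebra (𝓞 F) (integralClosure (𝓞 k) (AlgebraicClosure k)) :=
    (ringOfIntegersToIntegralClosure (k := k) (Ω := AlgebraicClosure k) F).toAlgebra
  haveI : IsScalarTower (𝓞 k) (𝓞 F) (integralClosure (𝓞 k) (AlgebraicClosure k)) :=
    IsScalarTower.of_algebraMap_eq (R := 𝓞 k) (S := 𝓞 F)
      (A := integralClosure (𝓞 k) (AlgebraicClosure k)) fun _ ↦ rfl
  intro x
  change IsIntegral (𝓞 F) x
  exact (Algebra.IsIntegral.isIntegral (R := 𝓞 k) x).tower_top

/-- `(𝔓̄ ∩ 𝓞 F) ∩ 𝓞 k = 𝔓̄ ∩ 𝓞 k`. [folklore] -/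
private theorem under_comap_eq (F : IntermediateField k (AlgebraicClosure k))
    (𝔓 : Ideal (absIntegers (𝓞 k) k)) :
    (𝔓.comap (ringOfIntegersToIntegralClosure (k := k) (Ω := AlgebraicClosure k) F)).under (𝓞 k) =
      𝔓.under (𝓞 k) := by
  ext x
  simp only [Ideal.under_def, Ideal.mem_comap]
  exact Iff.rfl

/-- `ι_F (τ|_F • x) = τ • ι_F x`. [folklore] -/
private theorem map_galois_smul (F : IntermediateField k (AlgebraicClosure k)) [Normal k F]
    (τ : absoluteGaloisGroup k) (x : 𝓞 F) :
    ringOfIntegersToIntegralClosure (k := k) (Ω := AlgebraicClosure k) F (absRestrictNormalHom F τ • x) =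
      τ • ringOfIntegersToIntegralClosure (k := k) (Ω := AlgebraicClosure k) F x := by
  apply Subtype.ext
  rw [integralClosure.coe_smul, coe_ringOfIntegersToIntegralClosure,
    coe_ringOfIntegersToIntegralClosure, RingOfIntegers.coe_galois_smul]
  exact AlgEquiv.restrictNormalHom_apply F _ _

set_option synthInstance.maxHeartbeats 200000 in
/-- `Stab_Γ(𝔓̄) ≤ Stab_Γ(𝔓̄ ∩ F)`: if `τ • 𝔓̄ = 𝔓̄` then `τ|_F` fixes `𝔓̄ ∩ 𝓞 F`. [folklore] -/
private theorem smul_comap_eq_of_smul_eq (F : IntermediateField k (AlgebraicClosure k)) [Normal k F]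
    {τ : absoluteGaloisGroup k} {𝔓 : Ideal (absIntegers (𝓞 k) k)} (h : τ • 𝔓 = 𝔓) :
    absRestrictNormalHom F τ •
        𝔓.comap (ringOfIntegersToIntegralClosure (k := k) (Ω := AlgebraicClosure k) F) =
      𝔓.comap (ringOfIntegersToIntegralClosure (k := k) (Ω := AlgebraicClosure k) F) := by
  ext x
  obtain ⟨y, hy⟩ : ∃ y : absIntegers (𝓞 k) k,
      ringOfIntegersToIntegralClosure (k := k) (Ω := AlgebraicClosure k) F x = y := ⟨_, rfl⟩
  have e : ringOfIntegersToIntegralClosure (k := k) (Ω := AlgebraicClosure k) F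
      ((absRestrictNormalHom F τ)⁻¹ • x) = τ⁻¹ • y := by
    rw [← map_inv, ← hy]
    exact map_galois_smul F τ⁻¹ x
  rw [Ideal.mem_pointwise_smul_iff_inv_smul_mem, Ideal.mem_comap, Ideal.mem_comap]
  erw [e, hy]
  have h' : τ⁻¹ • 𝔓 = 𝔓 := by rw [inv_smul_eq_iff, h]
  calc τ⁻¹ • y ∈ 𝔓 ↔ τ⁻¹ • y ∈ τ⁻¹ • 𝔓 := by rw [h']
    _ ↔ y ∈ 𝔓 := Ideal.smul_mem_pointwise_smul_iff

/-- `τ|_E = 1` iff `τ ∈ Gal(k̄/E)` (`fixingSubgroup`). [folklore] -/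
private theorem absRestrictNormalHom_eq_one_iff_mem_fixingSubgroup'
    (E : IntermediateField k (AlgebraicClosure k)) [Normal k E] (τ : absoluteGaloisGroup k) :
    absRestrictNormalHom E τ = 1 ↔ absoluteGaloisGroup.toAlgEquiv k τ ∈ E.fixingSubgroup := by
  have hc : ∀ x : E, ((absRestrictNormalHom E τ x : E) : AlgebraicClosure k) =
      τ • (x : AlgebraicClosure k) := fun x => AlgEquiv.restrictNormalHom_apply E _ x
  rw [IntermediateField.mem_fixingSubgroup_iff]
  constructor
  · intro h x hx
    change τ • x = x
    rw [← hc ⟨x, hx⟩, h, AlgEquiv.one_apply]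
  · intro h
    ext x
    rw [hc x, AlgEquiv.one_apply]
    exact h x x.2

/-- If `(τ)|_{E'} = 1` and `E ≤ E'` then `τ|_E = 1`. [folklore] -/
private theorem absRestrictNormalHom_eq_one_of_le'' {E E' : IntermediateField k (AlgebraicClosure k)}
    [Normal k E] [Normal k E'] (h : E ≤ E') (τ : absoluteGaloisGroup k)
    (hτ : absRestrictNormalHom E' τ = 1) : absRestrictNormalHom E τ = 1 := by
  rw [absRestrictNormalHom_eq_one_iff_mem_fixingSubgroup'] at hτ ⊢
  exact IntermediateField.fixingSubgroup_antitone h hτ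

variable [NumberField k]

/-- `g|_{K_m} = 1 ↔ g ∈ κ⁻¹(pᵐℤ_p)` (Krull–Galois for the layer, tree `fixingSubgroup_layer`). [folklore] -/
private theorem absRestrictNormalHom_layer_eq_one_iff' {p : ℕ} [Fact p.Prime] (κ : ZpExtension k p)
    (m : ℕ) [Normal k (κ.layer m)] (g : absoluteGaloisGroup k) :
    absRestrictNormalHom (κ.layer m) g = 1 ↔ g ∈ κ.layerSubgroup m := by
  rw [absRestrictNormalHom_eq_one_iff_mem_fixingSubgroup', κ.fixingSubgroup_layer m]
  constructor
  · rintro ⟨g', hg', hgg'⟩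
    have : g' = g := (absoluteGaloisGroup.toAlgEquiv k).injective hgg'
    exact this ▸ hg'
  · exact fun h => ⟨g, h, rfl⟩

/-! ### Ramified primes of `F ⊇ K_m` lie over `p` -/

/-- **A prime of `F ⊇ K_m` at which some `σ` with `σ|_{K_m} ≠ 1` is inert contains `p`.**  `k` a
number field, `κ` a `ℤ_p`-extension of `k` with layers `K_m = κ.layer m`, `F ⊆ k̄` finite Galois over
`k` containing `K_m`, `𝔓` a prime of `F`, `σ ∈ Γ_k` with `σ|_F` in the inertia group of `𝔓` and
`σ|_{K_m} ≠ 1`.  Then `p ∈ 𝔓`: otherwise the place `v = 𝔓 ∩ k` is prime to `p`, `σ|_F = g|_F` for some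
`g` in the inertia group `I_𝔓̄ ≤ Γ_k` of a prime `𝔓̄` of `ℤ̄_k` above `𝔓` (Serre I §7 Prop. 22 (b), tree
`inertia_comap_ringOfIntegers_eq_map_absRestrictNormalHom`), and `I_𝔓̄ ≤ ker κ ≤ κ⁻¹(pᵐℤ_p)`
(`ℤ_p`-extensions are unramified outside `p`, Washington Prop. 13.2, tree
`ZpExtension.inertia_le_kerSubgroup_holds`), so `σ|_{K_m} = g|_{K_m} = 1`.
[cite: Washington1997, §13.1 Prop. 13.2] [cite: SerreLocalFields1979, Ch. I §7 Prop. 22(b)] -/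
theorem natCast_mem_of_mem_inertia_of_absRestrictNormalHom_layer_ne_one {p : ℕ} [Fact p.Prime]
    (κ : ZpExtension k p) (m : ℕ) [Normal k (κ.layer m)]
    (F : IntermediateField k (AlgebraicClosure k)) [FiniteDimensional k F] [IsGalois k F]
    (hle : κ.layer m ≤ F) (𝔓 : Ideal (𝓞 F)) [𝔓.IsMaximal] {σ : absoluteGaloisGroup k}
    (hσI : absRestrictNormalHom F σ ∈ 𝔓.inertia (F ≃ₐ[k] F))
    (hσ : absRestrictNormalHom (κ.layer m) σ ≠ 1) :
    ((p : ℕ) : 𝓞 F) ∈ 𝔓 := by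
  by_contra hp𝔓
  obtain ⟨𝔓', h𝔓'prime, h𝔓'⟩ := exists_isPrime_comap_eq F 𝔓
  haveI := h𝔓'prime
  -- the place `v` of `k` under `𝔓`
  have hne : 𝔓.under (𝓞 k) ≠ ⊥ := by
    haveI : (𝔓.under (𝓞 k)).IsMaximal := Ideal.IsMaximal.under (𝓞 k) 𝔓
    exact Ring.ne_bot_of_isMaximal_of_not_isField inferInstance (RingOfIntegers.not_isField k)
  haveI : (𝔓.under (𝓞 k)).IsPrime := Ideal.IsPrime.under (𝓞 k) 𝔓
  set v : HeightOneSpectrum (𝓞 k) := ⟨𝔓.under (𝓞 k), inferInstance, hne⟩ with hvdef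
  have h𝔓'v : 𝔓' ∈ v.primesAbove := by
    refine ⟨h𝔓'prime, ⟨?_⟩⟩
    change 𝔓.under (𝓞 k) = 𝔓'.under (𝓞 k)
    rw [← h𝔓', under_comap_eq]
  have hpv : (p : 𝓞 k) ∉ v.asIdeal := by
    intro h
    apply hp𝔓
    have h' : algebraMap (𝓞 k) (𝓞 F) (p : 𝓞 k) ∈ 𝔓 := Ideal.mem_comap.mp h
    rwa [map_natCast] at h'
  -- lift `σ|_F` to the absolute inertia group of `𝔓'`
  have hσI' : absRestrictNormalHom F σ ∈
      (𝔓'.comap (ringOfIntegersToIntegralClosure (k := k) (Ω := AlgebraicClosure k) F)).inertia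
        (F ≃ₐ[k] F) := by
    rw [h𝔓']
    exact hσI
  rw [inertia_comap_ringOfIntegers_eq_map_absRestrictNormalHom F 𝔓'] at hσI'
  obtain ⟨g, hgI, hg⟩ := Subgroup.mem_map.mp hσI'
  have hgker : g ∈ κ.kerSubgroup := ZpExtension.inertia_le_kerSubgroup_holds k p κ hpv h𝔓'v hgI
  have hg1 : absRestrictNormalHom (κ.layer m) g = 1 :=
    (absRestrictNormalHom_layer_eq_one_iff' κ m g).mpr (κ.kerSubgroup_le_layerSubgroup m hgker)
  -- `σ` and `g` agree on `F`, hence on `K_m`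
  have h1 : absRestrictNormalHom F (g⁻¹ * σ) = 1 := by
    rw [map_mul, map_inv, hg, inv_mul_cancel]
  have h2 := absRestrictNormalHom_eq_one_of_le'' hle (g⁻¹ * σ) h1
  rw [map_mul, map_inv, hg1, inv_one, one_mul] at h2
  exact hσ h2

/-! ### (c3*) from the decomposition groups `D_v`, `v ∣ p` -/

set_option synthInstance.maxHeartbeats 200000 in
set_option maxHeartbeats 800000 in
/-- **`V^{Stab_Γ(𝔓)} = 0` from `V^{D_v} = 0`.**  `F ⊆ k̄` finite Galois over the number field `k`, `𝔓`
a prime of `F` containing the rational prime `p`, `V` a `Γ_k`-module such that for every finite place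
`v ∣ p` of `k` no non-zero vector is fixed by the decomposition group `D_v = GreenbergSelmer.decomp v`
(of the tree's chosen prime `𝔓₀` above `v`).  Then no non-zero `w ∈ V` is fixed by
`{τ ∈ Γ_k : τ|_F 𝔓 = 𝔓}`: with `𝔓 = 𝔓̄ ∩ F`, `𝔓̄ = g • 𝔓₀` (transitivity of `Γ_k` on the primes above
`v = 𝔓 ∩ k`, Neukirch I (9.1), tree `exists_smul_eq_of_mem_primesAbove_holds`;
`D_v = Stab_Γ(𝔓₀)`, Neukirch II (9.6), tree `decompositionSubgroup_adicCompletionPrime_eq_range`),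
`g⁻¹ • w` is fixed by `D_v`. [cite: NeukirchANT1999, Ch. I §9 (9.1) and Ch. II §9 (9.6)]
[cite: Greenberg1989, §1 p. 98] -/
theorem eq_zero_of_forall_stabilizer_smul_of_decomp
    (F : IntermediateField k (AlgebraicClosure k)) [FiniteDimensional k F] [IsGalois k F]
    (𝔓 : Ideal (𝓞 F)) [𝔓.IsMaximal] {p : ℕ} (hp𝔓 : ((p : ℕ) : 𝓞 F) ∈ 𝔓)
    {V : Type*} [AddCommGroup V] [DistribMulAction (absoluteGaloisGroup k) V]
    (hV : ∀ v : HeightOneSpectrum (𝓞 k), ((p : ℕ) : 𝓞 k) ∈ v.asIdeal →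
      ∀ w : V, (∀ d ∈ EllipticCurves.GreenbergSelmer.decomp v, d • w = w) → w = 0)
    (w : V) (hw : ∀ τ : absoluteGaloisGroup k, absRestrictNormalHom F τ • 𝔓 = 𝔓 → τ • w = w) :
    w = 0 := by
  obtain ⟨𝔓', h𝔓'prime, h𝔓'⟩ := exists_isPrime_comap_eq F 𝔓
  haveI := h𝔓'prime
  have hne : 𝔓.under (𝓞 k) ≠ ⊥ := by
    haveI : (𝔓.under (𝓞 k)).IsMaximal := Ideal.IsMaximal.under (𝓞 k) 𝔓
    exact Ring.ne_bot_of_isMaximal_of_not_isField inferInstance (RingOfIntegers.not_isField k)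
  haveI : (𝔓.under (𝓞 k)).IsPrime := Ideal.IsPrime.under (𝓞 k) 𝔓
  set v : HeightOneSpectrum (𝓞 k) := ⟨𝔓.under (𝓞 k), inferInstance, hne⟩ with hvdef
  have h𝔓'v : 𝔓' ∈ v.primesAbove := by
    refine ⟨h𝔓'prime, ⟨?_⟩⟩
    change 𝔓.under (𝓞 k) = 𝔓'.under (𝓞 k)
    rw [← h𝔓', under_comap_eq]
  have hpv : ((p : ℕ) : 𝓞 k) ∈ v.asIdeal := by
    change ((p : ℕ) : 𝓞 k) ∈ 𝔓.under (𝓞 k)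
    rw [Ideal.under_def, Ideal.mem_comap, map_natCast]
    exact hp𝔓
  -- `𝔓' = g • 𝔓₀`
  obtain ⟨g, hg⟩ := HeightOneSpectrum.exists_smul_eq_of_mem_primesAbove_holds
    (adicCompletionPrime_mem_primesAbove k v) h𝔓'v
  -- `g⁻¹ • w` is fixed by `D_v = Stab(𝔓₀)`
  have hfix : ∀ d ∈ EllipticCurves.GreenbergSelmer.decomp v, d • g⁻¹ • w = g⁻¹ • w := by
    intro d hd
    have hd' : d • adicCompletionPrime k v = adicCompletionPrime k v := by
      have hd2 : d ∈ (adicCompletionPrime k v).decompositionSubgroup (absoluteGaloisGroup k) := by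
        rw [decompositionSubgroup_adicCompletionPrime_eq_range]
        exact hd
      exact hd2
    have hstab : (g * d * g⁻¹) • 𝔓' = 𝔓' := by
      rw [← hg, mul_smul, mul_smul, inv_smul_smul, hd']
    have h1 : (g * d * g⁻¹) • w = w := by
      refine hw _ ?_
      rw [← h𝔓']
      exact smul_comap_eq_of_smul_eq F hstab
    calc d • g⁻¹ • w = g⁻¹ • ((g * d * g⁻¹) • w) := by
          rw [mul_smul, mul_smul, inv_smul_smul]
      _ = g⁻¹ • w := by rw [h1]
  have h0 := hV v hpv (g⁻¹ • w) hfix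
  rw [← smul_inv_smul g w, h0, smul_zero]

/-- **(c3*)ₙ for `L₀K_{n+1}/L₀K_n` from `V^{D_v} = 0`, `v ∣ p`** (the two previous theorems combined):
for `F ⊆ k̄` finite Galois containing the layer `K_m` and a prime `𝔓` of `F` at which some `σ ∈ Γ_k` with
`σ|_{K_m} ≠ 1` is inert, no non-zero vector of `V` is fixed by `{τ : τ|_F 𝔓 = 𝔓}`.
[cite: Washington1997, §13.1 Prop. 13.2] [cite: NeukirchANT1999, Ch. I §9 (9.1) and Ch. II §9 (9.6)] -/
theorem eq_zero_of_forall_stabilizer_smul_of_layer_ne_one {p : ℕ} [Fact p.Prime]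
    (κ : ZpExtension k p) (m : ℕ) [Normal k (κ.layer m)]
    (F : IntermediateField k (AlgebraicClosure k)) [FiniteDimensional k F] [IsGalois k F]
    (hle : κ.layer m ≤ F) (𝔓 : Ideal (𝓞 F)) [𝔓.IsMaximal]
    (hex : ∃ σ : absoluteGaloisGroup k, absRestrictNormalHom F σ ∈ 𝔓.inertia (F ≃ₐ[k] F) ∧
      absRestrictNormalHom (κ.layer m) σ ≠ 1)
    {V : Type*} [AddCommGroup V] [DistribMulAction (absoluteGaloisGroup k) V]
    (hV : ∀ v : HeightOneSpectrum (𝓞 k), ((p : ℕ) : 𝓞 k) ∈ v.asIdeal →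
      ∀ w : V, (∀ d ∈ EllipticCurves.GreenbergSelmer.decomp v, d • w = w) → w = 0)
    (w : V) (hw : ∀ τ : absoluteGaloisGroup k, absRestrictNormalHom F τ • 𝔓 = 𝔓 → τ • w = w) :
    w = 0 := by
  obtain ⟨σ, hσI, hσ⟩ := hex
  exact eq_zero_of_forall_stabilizer_smul_of_decomp F 𝔓
    (natCast_mem_of_mem_inertia_of_absRestrictNormalHom_layer_ne_one κ m F hle 𝔓 hσI hσ) hV w hw

/-! ### Door L6 for `L₀K_n` modulo the orbit input -/

set_option maxHeartbeats 1600000 in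
set_option synthInstance.maxHeartbeats 200000 in
/-- **The equivariant Iwasawa lemma along `L_n = L₀K_n`, `K_n` the layers of a `ℤ_p`-extension, with
(c3*) in place-wise form.**  `k` a number field, `p` an odd prime, `κ` a `ℤ_p`-extension of `k` with layers
`K_n = κ.layer n` (finite Galois over `k`; tree `finiteDimensional_layer_holds`, `isGalois_layer_holds`),
`L₀ ⊆ k̄` finite Galois over `k` with `p ∤ [L₀ : k]`, `V` a `p`-torsion `Γ_k`-module on which `Γ_{L₀}` acts
trivially.  Assume (c2*) every additive `Γ_k`-equivariant `Cl(𝓞_{L₀}) → V` is zero; (c3*) for every finite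
place `v ∣ p` of `k`, `V^{D_v} = 0` (`D_v = GreenbergSelmer.decomp v`); and (orbit)ₙ for every `n` there are
a maximal ideal `𝔓̄` of `ℤ̄_k` and `σ` in its inertia group `I_𝔓̄ ≤ Γ_k` with `σ|_{L₀} = 1`,
`σ ∈ κ⁻¹(pⁿℤ_p)`, `σ ∉ κ⁻¹(pⁿ⁺¹ℤ_p)`, such that the prime `𝔓̄ ∩ L₀K_{n+1}` has a number of
`Gal(L₀K_{n+1}/k)`-conjugates prime to `p`.  Then for every `n` every additive `Γ_k`-equivariant
`Cl(𝓞_{L₀K_n}) → V` is zero.  (`equivariantHom_classGroup_eq_zero_compositum_tower` with its hypothesis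
(c3*)ₙ discharged by `eq_zero_of_forall_stabilizer_smul_of_layer_ne_one` and its ramified prime produced
from `𝔓̄`, `σ` through `inertia_comap_ringOfIntegers_eq_map_absRestrictNormalHom`.)  For `k = ℚ`, `κ`
cyclotomic, `L₀ = ℚ(E[p])`, `V = E[p]`: door L6 of the cell's census, the orbit input being
«`p` is totally ramified in `ℚ_∞`» (tree `IsCyclotomic.inertia_sup_kerSubgroup_eq_top`) + (c1).
[cite: Washington1997, §13.1 Prop. 13.2, §13.3 Lemmas 13.14–13.15 and Thm. 10.4 (proof)]
[cite: NeukirchANT1999, Ch. I §9 (9.1), Ch. II §9 (9.6), Ch. VI (6.9), (7.1) and Ch. IV §6] -/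
theorem equivariantHom_classGroup_eq_zero_layer_compositum_tower {p : ℕ} [Fact p.Prime]
    (hp2 : p ≠ 2) (κ : ZpExtension k p)
    (L₀ : IntermediateField k (AlgebraicClosure k)) [FiniteDimensional k L₀] [IsGalois k L₀]
    (hL₀ : ¬ p ∣ Module.finrank k L₀)
    [hfd : ∀ n, FiniteDimensional k (κ.layer n)] [hgal : ∀ n, IsGalois k (κ.layer n)]
    [hNF : ∀ n, NumberField (L₀ ⊔ κ.layer n : IntermediateField k (AlgebraicClosure k))]
    {V : Type*} [AddCommGroup V] [DistribMulAction (absoluteGaloisGroup k) V]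
    (hpV : ∀ v : V, p • v = 0)
    (hV : ∀ τ : absoluteGaloisGroup k, absRestrictNormalHom L₀ τ = 1 → ∀ v : V, τ • v = v)
    (h0 : ∀ μ : Additive (ClassGroup (𝓞 L₀)) →+ V,
      (∀ (τ : absoluteGaloisGroup k) (c : ClassGroup (𝓞 L₀)),
        μ (Additive.ofMul (ClassGroup.mulEquiv
          (AmbiguousClass.intAut (absRestrictNormalHom L₀ τ)) c)) = τ • μ (Additive.ofMul c)) →
      μ = 0)
    (hD : ∀ v : HeightOneSpectrum (𝓞 k), ((p : ℕ) : 𝓞 k) ∈ v.asIdeal →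
      ∀ w : V, (∀ d ∈ EllipticCurves.GreenbergSelmer.decomp v, d • w = w) → w = 0)
    (horb : ∀ n : ℕ, ∃ (𝔓' : Ideal (absIntegers (𝓞 k) k)) (_ : 𝔓'.IsMaximal)
      (σ : absoluteGaloisGroup k), σ ∈ 𝔓'.inertia (absoluteGaloisGroup k) ∧
        absRestrictNormalHom L₀ σ = 1 ∧ σ ∈ κ.layerSubgroup n ∧ σ ∉ κ.layerSubgroup (n + 1) ∧
        ¬ p ∣ (MulAction.stabilizer
          ((L₀ ⊔ κ.layer (n + 1) : IntermediateField k (AlgebraicClosure k)) ≃ₐ[k]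
            (L₀ ⊔ κ.layer (n + 1) : IntermediateField k (AlgebraicClosure k)))
          (𝔓'.comap (ringOfIntegersToIntegralClosure (k := k) (Ω := AlgebraicClosure k)
            (L₀ ⊔ κ.layer (n + 1) : IntermediateField k (AlgebraicClosure k))))).index)
    (n : ℕ)
    (f : Additive (ClassGroup (𝓞 (L₀ ⊔ κ.layer n : IntermediateField k (AlgebraicClosure k)))) →+ V)
    (hf : ∀ (τ : absoluteGaloisGroup k)
        (c : ClassGroup (𝓞 (L₀ ⊔ κ.layer n : IntermediateField k (AlgebraicClosure k)))),
      f (Additive.ofMul (ClassGroup.mulEquiv (AmbiguousClass.intAut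
        (absRestrictNormalHom (L₀ ⊔ κ.layer n : IntermediateField k (AlgebraicClosure k)) τ)) c)) =
        τ • f (Additive.ofMul c)) :
    f = 0 := by
  haveI hKn : ∀ m, Normal k (κ.layer m) := fun m => inferInstance
  refine equivariantHom_classGroup_eq_zero_compositum_tower (hKab := fun m => κ.isAbelianGalois_layer m)
    p hp2 L₀ hL₀ κ.layer (fun m => κ.layer_mono (Nat.le_succ m)) κ.layer_zero
    (fun m => κ.finrank_layer_holds m) hpV hV h0 ?_ ?_ n f hf
  · -- (c3*)ₙ from the place-wise (c3*)
    intro m 𝔓 _ hex w hw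
    obtain ⟨σ, hI, -, -, hne⟩ := hex
    exact eq_zero_of_forall_stabilizer_smul_of_layer_ne_one κ (m + 1)
      (L₀ ⊔ κ.layer (m + 1) : IntermediateField k (AlgebraicClosure k)) le_sup_right 𝔓 ⟨σ, hI, hne⟩
      hD w hw
  · -- the ramified prime with few conjugates, from `𝔓̄` and `σ`
    intro m
    obtain ⟨𝔓', h𝔓'max, σ, hσI, h0σ, hn, hn1, hidx⟩ := horb m
    haveI : 𝔓'.IsMaximal := h𝔓'max
    haveI : (𝔓'.comap (ringOfIntegersToIntegralClosure (k := k) (Ω := AlgebraicClosure k)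
        (L₀ ⊔ κ.layer (m + 1) : IntermediateField k (AlgebraicClosure k)))).IsMaximal :=
      @Ideal.isMaximal_comap_of_isIntegral_of_isMaximal' _ _ _ _ _
        (isIntegral_ringOfIntegersToIntegralClosure _) 𝔓' h𝔓'max
    refine ⟨_, this, ⟨σ, ?_, h0σ, (absRestrictNormalHom_layer_eq_one_iff' κ m σ).mpr hn,
      fun h => hn1 ((absRestrictNormalHom_layer_eq_one_iff' κ (m + 1) σ).mp h)⟩, hidx⟩
    rw [inertia_comap_ringOfIntegers_eq_map_absRestrictNormalHom
      (L₀ ⊔ κ.layer (m + 1) : IntermediateField k (AlgebraicClosure k)) 𝔓']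
    exact Subgroup.mem_map_of_mem _ hσI

end Ramification

end EquivariantIwasawaLemma

end Literature.NumberTheory.NumberFields

end
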